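import Summits.CriticalPhenomena.PercolationContinuityZ3.Theorems.PercNearOneGluingNoHeavyLowerTailCSHPhiMarkov
import Literature.Probability.Percolation.TwoSetConditionalAssociationRC
import HarnessLib

/-!
# FK sub-lane: the residual functional `Φ_FK` of the world-wise unfolding for `φ_{w,q}` — DEFINITIONS, the `q = 1` bridge,
# and the LOCATED open statement `FK.PhiFKMonotone q` (Lemma Φ(b) for the random-cluster measure)

Definitions file (`--supports stmt-CriticalPhenomena-4575`), FK sub-lane `prim-bschramm-fk-1` (gen 2) of the post-continuity programme;
builds on p205010 (kernel theorem, internal audit signed; external expert review pending).  No named facts, no sorries; standard axioms.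
NOTHING is asserted here for `q ≠ 1`.

WHERE THIS SITS.  For `q ≥ 1` the FK finite leg `AdditiveGluingFK q ⟸ CSHFK q ⟸ hU` (one-level unfolding step: Lemma U_FK + Lemma H_FK)
is kernel-checked (`FK.additiveGluingFK_of_cshFK`, `FK.cshFK_of_unfold`).  Reading prim-hp-8's Lemma U (memo PROOF-S5-ALL-R.md §3.3) for
`φ_{w,q}`: the CLAIM is linear algebra, the world dictionary and "Markov at `K`" are van den Berg–Häggström–Kahn's Lemmas 2.3/2.4 for
`φ_{𝐩,q}` (tree), Lemma Φ(a) is Markov — but Lemma Φ(b) ("the residual functional is INCREASING in `K`", needed because `Φ` is the functional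
handed to the LOWER-LEVEL hierarchy) is proved at `q = 1` by the POINTWISE coupling `CSH.phiIntegrand_mono` together with the
identification `CSH.sum_phiIntegrand_eq` (`…CSHPhiMarkov.lean`), which uses the product structure twice (law of `ω ∖ K̄` under `P_w`;
freshness of the unexplored pairs INCLUDING those at `K`).  For `φ_{w,q}` the functional is FORCED by the worlds of Lemma T_rc
(`BHK2006_multiMarkerCov_nonneg_of_within_rc`: `φ^ω = rcMeasureW (delW w A_Y(ω)) q ∅`):

  `Φ_FK(K) = ∫_{x ↮ Y} ( a_G(C_Y(ω)) − g(C_x(ω)) ) dφ_{G−K̄}(ω)`,   `a_G(W) = ∫ g(C_x) dφ_{G−W̄}`   (`K̄`, `W̄` = the pairs meeting `K`, `W`).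

* `FK.worldMeanY w q x Y g ω` — the world mean `a_G(C_Y(ω))` in Lemma T_rc's vocabulary;
* `FK.phiFK w q x Y g K` — `Φ_FK(K)`;
* `FK.worldMeanY_one`, **`FK.phiFK_one : FK.phiFK w 1 x Y g K = CSH.phiFun w x Y g K`** — at `q = 1` this IS prim-hp-8's residual functional
  (via `CSH.sum_phiIntegrand_eq`, `rcMeasureW_one`, `HullPort.integral_comp_sdiff_prodBernoulli`);
* `FK.PhiFKMonotone q` — THE LOCATED STATEMENT: `K ↦ Φ_FK(K)` is monotone for every finite weighted graph, owner, avoided set and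
  monotone `g` (a `Prop`-valued predicate of `q`; NOT asserted); `FK.phiFKMonotone_one : PhiFKMonotone 1` (= `CSH.phiFun_mono`).
STATUS for `q > 1`: OPEN; exact-census clean (fk-1 gen 2, 2026-08-20, pure-python Fractions, `n ≤ 5`, `q ∈ {3/2, 2, 10}`): monotone in
0/13,088 cells; the equivalent edge form (Russo's formula for `φ_{𝐩,q}`) `Cov_{φ_H}((a_G(C_Y) − g(C_x))1{x∉C_Y}, ω_e) ≤ 0` for all `H ≤ G`:
0/397,860; with general increasing test functions 0/938,880 (bschramm/FK-DEFS.md §6.2).  `Φ_FK ≥ 0` for `q ≥ 1` is elementary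
(comparison in `𝐩` inside each world) and is not recorded here.
[cite: VandenbergHaggstromKahn2005, §2.1 Lemmas 2.3–2.4 (p. 10); §1 pp. 3–5 (clusters in `G − Z`)] [cite: Grimmett2006, §1.4 eq. (1.20) (p. 15); Thm. (3.8)]
-/

noncomputable section

namespace Summit.CriticalPhenomena.PercolationContinuityZ3.Theorems

open MeasureTheory Set Literature.Probability.LatticeModels Literature.Probability.Percolation
open scoped Classical
open BHK2006 DecisionTree HullPort

namespace FK

variable {V : Type*} [Fintype V]

/-- **The world mean `a_G(C_Y(ω))`**: the expectation of `g(C_x)` under the random-cluster measure with the pairs meeting the open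
vertex cluster of `Y` in `ω` deleted (same `q`) — the world of van den Berg–Häggström–Kahn's Lemma 2.3/2.4 for `φ_{𝐩,q}`, in the
vocabulary of `BHK2006_multiMarkerCov_nonneg_of_within_rc`. [cite: VandenbergHaggstromKahn2005, §2.1 Lemma 2.3 (p. 10)] -/
def worldMeanY (w : Sym2 V → unitInterval) (q : ℝ) (x : V) (Y : Set V) (g : Set (Sym2 V) → ℝ) (ω : BondConfig V) : ℝ :=
  ∫ η, g (openEdgeCluster η x) ∂(rcMeasureW (delW w {e | ∃ z ∈ e, ∃ y ∈ Y, (openGraph ω).Reachable y z}) q ∅)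

/-- **The residual functional `Φ_FK(K)` of the world-wise unfolding for `φ_{w,q}`**:
`Φ_FK(K) = ∫_{x ↮ Y} (a_G(C_Y(ω)) − g(C_x(ω))) dφ_{G−K̄}(ω)`, `φ_{G−K̄} = rcMeasureW (delW w (edgesOf K)) q ∅` (the pairs meeting `K`
deleted), `a_G` the world mean computed in `G` (NOT in `G − K̄`).  At `q = 1` it is prim-hp-8's `CSH.phiFun` (`FK.phiFK_one`).
(transcription of the cell memo prim-hp-8 PROOF-S5-ALL-R.md §3.2, FK-parametrised) [cite: VandenbergHaggstromKahn2005, §2.1 Lemmas 2.3–2.4 (p. 10)] -/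
def phiFK (w : Sym2 V → unitInterval) (q : ℝ) (x : V) (Y : Set V) (g : Set (Sym2 V) → ℝ) (K : Set V) : ℝ :=
  ∫ ω in {ω : BondConfig V | ∀ y ∈ Y, ¬ (openGraph ω).Reachable x y},
    (worldMeanY w q x Y g ω - g (openEdgeCluster ω x)) ∂(rcMeasureW (delW w (CSH.edgesOf K)) q ∅)

/-- **LEMMA Φ(b) FOR THE RANDOM-CLUSTER MEASURE — the located open statement of the FK finite leg** (parametrised by `q`; NOT
asserted): for every finite vertex type `Fin n`, every parameter vector `w`, every owner `x`, avoided set `Y` and monotone functional `g`,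
`K ↦ Φ_FK(K)` is monotone.  `q = 1`: `FK.phiFKMonotone_one` (prim-hp-8's `CSH.phiFun_mono`, builds on p205010 (kernel theorem, internal
audit signed; external expert review pending)).  `q > 1`: open; exact-census clean on `n ≤ 5` (fk-1 gen 2, bschramm/FK-DEFS.md §6.2).
This is the input of Lemma U_FK (the functional handed to the lower-level hierarchy must be increasing).
(transcription of the cell memo prim-hp-8 PROOF-S5-ALL-R.md §3.2(b), FK-parametrised) [cite: VandenbergHaggstromKahn2005, §2.1 (pp. 9–13)] -/
def PhiFKMonotone (q : ℝ) : Prop :=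
  ∀ (n : ℕ) (w : Sym2 (Fin n) → unitInterval) (x : Fin n) (Y : Set (Fin n)) (g : Set (Sym2 (Fin n)) → ℝ),
    Monotone g → Monotone (phiFK w q x Y g)

/-! ### `q = 1`: the FK residual functional is prim-hp-8's `CSH.phiFun` -/

/-- At `q = 1` the world mean is the sum-level `CSH.wmeanOff` (product dictionary: deleting the cut = switching it off).
[cite: VandenbergHaggstromKahn2005, §2.1 Lemma 2.3 (p. 10)] -/
theorem worldMeanY_one (w : Sym2 V → unitInterval) (x : V) (Y : Set V) (g : Set (Sym2 V) → ℝ) (ω : BondConfig V) :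
    worldMeanY w 1 x Y g ω = CSH.wmeanOff (fun e => (w e : ℝ)) Y (fun β => g (openEdgeCluster β x)) ω := by
  unfold worldMeanY CSH.wmeanOff
  rw [rcMeasureW_one]
  have hcut : {e : Sym2 V | ∃ z ∈ e, ∃ y ∈ Y, (openGraph ω).Reachable y z} = cut Y ω := rfl
  rw [hcut]
  have h := BHK2006.integral_comp_sdiff_prodBernoulli w (cut Y ω) (fun β => g (openEdgeCluster β x))
  have e : (fun e => if e ∈ cut Y ω then (0 : unitInterval) else w e) = delW w (cut Y ω) := rfl
  rw [e] at h
  rw [← h, integral_prodBernoulli_eq_sum]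

/-- **`q = 1` bridge: `Φ_FK = Φ`** — the FK residual functional at `q = 1` is prim-hp-8's pointwise-coupled `CSH.phiFun`
(Lemma Φ(a) `CSH.sum_phiIntegrand_eq` read backwards, `rcMeasureW_one`, deleting = switching off).
[cite: VandenbergHaggstromKahn2005, §2.1 Lemma 2.4 (p. 10)] -/
theorem phiFK_one (w : Sym2 V → unitInterval) (x : V) (Y : Set V) (g : Set (Sym2 V) → ℝ) (K : Set V) :
    phiFK w 1 x Y g K = CSH.phiFun w x Y g K := by
  classical
  set ŵ : Sym2 V → ℝ := fun e => (w e : ℝ) with hŵ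
  have hm : ∑ ω, weight ŵ ω = 1 := by
    have h1 := integral_prodBernoulli_eq_sum w fun _ => (1 : ℝ)
    simp only [integral_const, probReal_univ, smul_eq_mul, mul_one] at h1
    exact h1.symm
  -- the integrand of `Φ_FK` at `q = 1`, as a function of the configuration
  set F : BondConfig V → ℝ := fun ζ => ind (avoidEv x Y) ζ *
    (CSH.wmeanOff ŵ Y (fun β => g (openEdgeCluster β x)) ζ - g (openEdgeCluster ζ x)) with hF
  have hlhs : phiFK w 1 x Y g K = ∫ ζ, F ζ ∂(prodBernoulli fun e => if e ∈ CSH.edgesOf K then (0 : unitInterval) else w e) := by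
    unfold phiFK
    rw [rcMeasureW_one, ← integral_indicator MeasurableSet.of_discrete]
    have e1 : delW w (CSH.edgesOf K) = fun e => if e ∈ CSH.edgesOf K then (0 : unitInterval) else w e := rfl
    rw [e1]
    refine integral_congr_ae (Filter.Eventually.of_forall fun ζ => ?_)
    simp only [hF]
    by_cases hζ : ζ ∈ {ω : BondConfig V | ∀ y ∈ Y, ¬ (openGraph ω).Reachable x y}
    · rw [Set.indicator_of_mem hζ, ind_of_mem (show ζ ∈ avoidEv x Y from hζ), one_mul, worldMeanY_one]
    · rw [Set.indicator_of_notMem hζ, ind_of_not_mem (show ζ ∉ avoidEv x Y from hζ), zero_mul]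
  rw [hlhs, ← BHK2006.integral_comp_sdiff_prodBernoulli w (CSH.edgesOf K) F, integral_prodBernoulli_eq_sum]
  unfold CSH.phiFun
  rw [integral_prodBernoulli_eq_sum, CSH.sum_phiIntegrand_eq ŵ hm x Y K g]

/-- **`q = 1`: Lemma Φ(b) holds** — `FK.PhiFKMonotone 1` is prim-hp-8's `CSH.phiFun_mono` through the bridge `FK.phiFK_one`
(builds on p205010 (kernel theorem, internal audit signed; external expert review pending)).
[cite: VandenbergHaggstromKahn2005, §2.1 (pp. 9–13)] -/
theorem phiFKMonotone_one : PhiFKMonotone 1 := by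
  intro n w x Y g hg K K' hKK'
  rw [phiFK_one, phiFK_one]
  exact CSH.phiFun_mono w x Y hg hKK'

end FK

end Summit.CriticalPhenomena.PercolationContinuityZ3.Theorems

end
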